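import Literature.NumberTheory.EllipticCurves.Kato2004.EllipticUnitTatePairingValuesKOfGross
import Literature.NumberTheory.EllipticCurves.NewformsGaloisConjugateProofs
import Literature.NumberTheory.EllipticCurves.NewformsRealCoefficients
import Literature.NumberTheory.EllipticCurves.SharpFlatPAdicLFunctionCoeffField
import Literature.NumberTheory.Automorphic.GaloisActionPlaces
import Literature.NumberTheory.LFunctions.RayClassCharacter
import Summits.BirchSwinnertonDyer.BirchSwinnertonDyer.Theorems.SignedLowerHalvesSmallImageLowerHalfBothSignsRttF1ConjReindex
import HarnessLib

/-!
# F1 → THE MATCH: CM-reality `ψ(c • w) = ψ̄(w)` of the crux's Grössencharakter from UNIQUENESS UP TO CONJUGATION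

Summit `BirchSwinnertonDyer`, crux `SmallImageLowerHalfBothSigns` (stmt-23599), line `rtt_w3`, stub S4‴ (LEAD ruling «R-hψc», 2026-08-31: premise `hψc` now,
glue at the crux level). Namespace `…Theorems.SmallImageRttF1Bridge`. THEOREMS ONLY.

The crux prefix pins the Grössencharakter `ψ` (mod `𝔪`, type `(1,0)` at `σK`) to the CM newform `g` through the prime-trace sums
`hcoeffψ : a_ℓ(g)^{ι} = e⁻¹(Σ_{N w = ℓ} ψ(w))` (`ℓ ∤ d_K·N𝔪`). The conjugate newform `g′ = g^{e∘ι}` (tree `GaloisConjugate.exists_isNewform0_conj`) has REAL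
Fourier coefficients (tree `IsNewform0.conj_cuspCoeff`), so `ψ′ := \overline{ψ ∘ c}` — again a Grössencharakter, mod `c • 𝔪`, of the same type
(`isGrossencharakter_conj_smul`) — has the same prime-trace sums as `ψ` (`finsum_conj_smul_eq`). UNIQUENESS UP TO CONJUGATION (the hypothesis `hU`:
two Grössencharaktere of type `(1,0)` with the same prime-trace sums off finitely many `ℓ` agree off their moduli, or differ by `c`) then leaves
`ψ′ = ψ` — which IS CM-reality, two-sided — or `ψ′ = ψ ∘ c`, i.e. `ψ` real-valued off `𝔪`, which contradicts the infinity type (`ψ((α)) = σK(α) ∉ ℝ`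
for a suitable `α ≡ 1 (𝔪·c𝔪)`, `exists_sub_one_mem_im_ne_zero`).

* `isGrossencharakter_conj_smul` — `w ↦ \overline{ψ(c • w)}` is a Grössencharakter mod `c • 𝔪` of type `(embType σK, embTypeConj σK)`.
* `finsum_conj_smul_eq` — `Σ_{N w = ℓ} \overline{ψ(c • w)} = \overline{Σ_{N w = ℓ} ψ(w)}`.
* `not_forall_conj_eq_self` — a Grössencharakter of type `(1,0)` is not real-valued off its modulus.
* ★★ `hψc_of_uniq` — CM-reality (two-sided) of the crux's `ψ` from the prefix data `hψ`, `hcoeffψ`, `IsNewform0 g` and the uniqueness hypothesis `hU`.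

References: [Ribet1977Nebentypus] §3–§4 (CM forms and their Grössencharaktere); [Shimura1971] Thm. 3.48 (real Hecke field); [SilvermanATAEC1994] II Ex. 2.30.
-/

-- the Theorems namespace of this sub repeats the summit name by design (D-0017 nested layout)
set_option linter.dupNamespace false

noncomputable section

open scoped Classical NumberField ComplexConjugate Pointwise MatrixGroups ModularForm
open NumberField IsDedekindDomain Field

namespace Summit.BirchSwinnertonDyer.BirchSwinnertonDyer.Theorems.SmallImageRttF1Bridge

open Literature.NumberTheory.EllipticCurves Literature.NumberTheory.EllipticCurves.ModularForms
  Literature.NumberTheory.GaloisRepresentations Literature.NumberTheory.LFunctions Literature.NumberTheory.Automorphic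
  Literature.NumberTheory.EllipticCurves.Kato2004.CM CongruenceSubgroup

variable {K : Type} [Field K] [NumberField K]

/-! ## §1. Bookkeeping for the Galois action on ideals -/

/-- Coprimality is invariant under a common Galois conjugation. [cite: NeukirchANT1999, Ch. I §9 (before (9.1))] -/
theorem isCoprime_smul_smul (c : K ≃ₐ[ℚ] K) {I J : Ideal (𝓞 K)} (h : IsCoprime I J) : IsCoprime (c • I) (c • J) := by
  rw [Ideal.isCoprime_iff_sup_eq] at h ⊢
  have h' := congrArg (fun L : Ideal (𝓞 K) ↦ c • L) h
  simp only [Ideal.smul_sup, smul_top_ideal] at h'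
  exact h'

/-- For an involution `c`: `𝔪 ≤ c • P ↔ c • 𝔪 ≤ P`. [cite: NeukirchANT1999, Ch. I §9 (before (9.1))] -/
theorem le_smul_iff_smul_le {c : K ≃ₐ[ℚ] K} (hc2 : c * c = 1) (𝔪 P : Ideal (𝓞 K)) : 𝔪 ≤ c • P ↔ c • 𝔪 ≤ P := by
  have hinv : c⁻¹ = c := inv_eq_of_mul_eq_one_right hc2
  rw [Ideal.subset_pointwise_smul_iff, hinv]

/-! ## §2. The conjugate Grössencharakter `w ↦ ψ̄(c • w)` -/

section Conj

variable [IsTotallyComplex K] (σK : K →+* ℂ) (c : K ≃ₐ[ℚ] K)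

omit [IsTotallyComplex K] in
/-- `ψ′((x)) = \overline{ψ((c x))}` for the prime function `ψ′ = \overline{ψ ∘ (c • ·)}`. [cite: NeukirchANT1999, Ch. VII §6 (6.1)] -/
theorem idealPow_conj_smul_span (ψ : HeightOneSpectrum (𝓞 K) → ℂ) {x : 𝓞 K} (hx : x ≠ 0) :
    idealPow K (fun w ↦ conj (ψ (c • w))) (Ideal.span {x}) = conj (idealPow K ψ (Ideal.span {c • x})) := by
  have hx0 : (Ideal.span {x} : Ideal (𝓞 K)) ≠ ⊥ := by rwa [Ne, Ideal.span_singleton_eq_bot]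
  rw [show (Ideal.span {c • x} : Ideal (𝓞 K)) = c • Ideal.span {x} by rw [Ideal.smul_closure, Set.smul_set_singleton],
    idealPow_smul c ψ hx0]
  unfold idealPow
  rw [map_finprod _ (mulSupport_idealPow_finite (fun w ↦ ψ (c • w)) hx0)]
  exact finprod_congr fun v ↦ by rw [map_pow]

/-- ★ **The conjugate Grössencharakter.** If `ψ` is a Grössencharakter mod `𝔪` of type `(embType σK, embTypeConj σK)` of the totally complex field
`K`, and `c` is an involution of `K` with `σK ∘ c = \overline{σK}`, then `w ↦ \overline{ψ(c • w)}` is a Grössencharakter mod `c • 𝔪` of the same type: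
`ψ′((b)) = \overline{ψ((c b))} = \overline{ψ((c c₀))·σK(c(b/c₀))} = ψ′((c₀))·σK(b/c₀)` on the ray mod `c • 𝔪`. [cite: NeukirchANT1999, Ch. VII §6 Def. (6.1)] -/
theorem isGrossencharakter_conj_smul (hc2 : c * c = 1) (hσc : ∀ x : K, σK (c x) = conj (σK x)) {𝔪 : Ideal (𝓞 K)}
    {ψ : HeightOneSpectrum (𝓞 K) → ℂ} (hψ : IsGrossencharakter 𝔪 (embType σK) (embTypeConj σK) ψ) :
    IsGrossencharakter (c • 𝔪) (embType σK) (embTypeConj σK) (fun w ↦ conj (ψ (c • w))) := by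
  have hcc : ∀ I : Ideal (𝓞 K), c • c • I = I := fun I ↦ by rw [smul_smul, hc2, one_smul]
  refine ⟨fun v hv ↦ ?_, fun b c₀ hb hc₀ hcop hbc _ ↦ ?_⟩
  · -- nonvanishing off `c • 𝔪`
    rw [map_ne_zero_iff _ (RingHom.injective _)]
    refine hψ.ne_zero (c • v) fun hle ↦ hv ?_
    rwa [HeightOneSpectrum.smul_asIdeal, le_smul_iff_smul_le hc2] at hle
  · -- the infinity type on the ray mod `c • 𝔪`
    have hcb : c • b ≠ 0 := fun h ↦ hb (by rwa [smul_eq_zero_iff_eq] at h)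
    have hcc₀ : c • c₀ ≠ 0 := fun h ↦ hc₀ (by rwa [smul_eq_zero_iff_eq] at h)
    have hcop' : IsCoprime (Ideal.span {c • c₀}) 𝔪 := by
      have h := isCoprime_smul_smul c hcop
      rwa [Ideal.smul_closure, Set.smul_set_singleton, hcc] at h
    have hbc' : c • b - c • c₀ ∈ 𝔪 := by
      rw [← smul_sub, ← hcc 𝔪]
      exact Ideal.smul_mem_pointwise_smul _ _ _ hbc
    have hpos' : ∀ φ : K →+* ℝ, 0 < φ (c • b) * φ (c • c₀) := fun φ ↦ (not_nonempty_ringHom_real_of_isTotallyComplex K φ).elim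
    have key := hψ.idealPow_span_eq (c • b) (c • c₀) hcb hcc₀ hcop' hbc' hpos'
    rw [prod_embedding_zpow_embType] at key
    rw [idealPow_conj_smul_span c ψ hb, idealPow_conj_smul_span c ψ hc₀, key, map_mul, prod_embedding_zpow_embType,
      RingOfIntegers.coe_algEquiv_smul, RingOfIntegers.coe_algEquiv_smul, ← map_div₀, hσc, Complex.conj_conj]

end Conj

/-! ## §3. Prime-trace sums of the conjugate character -/

/-- The primes of a given norm form a finite set. [cite: NeukirchANT1999, Ch. I §6 (finiteness of ideals of bounded norm)] -/
theorem finite_setOf_absNorm_asIdeal_eq (ℓ : ℕ) : {w : HeightOneSpectrum (𝓞 K) | Ideal.absNorm w.asIdeal = ℓ}.Finite := by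
  refine Set.Finite.preimage (f := fun w : HeightOneSpectrum (𝓞 K) ↦ w.asIdeal) (s := {I : Ideal (𝓞 K) | Ideal.absNorm I = ℓ}) ?_
    (Ideal.finite_setOf_absNorm_eq ℓ)
  exact fun w _ w' _ h ↦ HeightOneSpectrum.ext h

/-- ★ **`Σ_{N w = ℓ} \overline{ψ(c • w)} = \overline{Σ_{N w = ℓ} ψ(w)}`** (reindex by `w ↦ c • w`, which preserves the norm).
[cite: NeukirchANT1999, Ch. I §9 (before (9.1))] -/
theorem finsum_conj_smul_eq (c : K ≃ₐ[ℚ] K) (ψ : HeightOneSpectrum (𝓞 K) → ℂ) (ℓ : ℕ) :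
    ∑ᶠ (w : HeightOneSpectrum (𝓞 K)) (_ : Ideal.absNorm w.asIdeal = ℓ), conj (ψ (c • w)) =
      conj (∑ᶠ (w : HeightOneSpectrum (𝓞 K)) (_ : Ideal.absNorm w.asIdeal = ℓ), ψ w) := by
  set A : Set (HeightOneSpectrum (𝓞 K)) := {w | Ideal.absNorm w.asIdeal = ℓ} with hA
  have hfin : A.Finite := finite_setOf_absNorm_asIdeal_eq ℓ
  change ∑ᶠ w ∈ A, conj (ψ (c • w)) = conj (∑ᶠ w ∈ A, ψ w)
  rw [show conj (∑ᶠ w ∈ A, ψ w) = ∑ᶠ w ∈ A, conj (ψ w) from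
    AddMonoidHom.map_finsum_mem ψ ((starRingEnd ℂ : ℂ →+* ℂ) : ℂ →+ ℂ) hfin]
  refine finsum_mem_eq_of_bijOn (fun w ↦ c • w) ⟨fun w hw ↦ ?_, (MulAction.injective c).injOn, fun w hw ↦ ⟨c⁻¹ • w, ?_, smul_inv_smul c w⟩⟩
    fun w _ ↦ rfl
  · show Ideal.absNorm (c • w).asIdeal = ℓ
    rw [HeightOneSpectrum.absNorm_algEquiv_smul]; exact hw
  · show Ideal.absNorm (c⁻¹ • w).asIdeal = ℓ
    rw [HeightOneSpectrum.absNorm_algEquiv_smul]; exact hw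

/-! ## §4. A Grössencharakter of type `(1,0)` is not real-valued -/

section NotReal

variable [IsTotallyComplex K] (σK : K →+* ℂ)

/-- **A non-real integer `≡ 1 (mod I)`**: for `I ≠ 0` there is `α ∈ 𝓞 K`, `α ≠ 0`, `α − 1 ∈ I`, with `σK(α) ∉ ℝ` (`α = 1 + N(I)·ω` for an integer
`ω` with `σK(ω) ∉ ℝ`, which exists since `σK` is not a real embedding of the totally complex `K`). [cite: NeukirchANT1999, Ch. III §1 (complex places)] -/
theorem exists_sub_one_mem_im_ne_zero {I : Ideal (𝓞 K)} (hI : I ≠ ⊥) :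
    ∃ α : 𝓞 K, α ≠ 0 ∧ α - 1 ∈ I ∧ (σK (α : K)).im ≠ 0 := by
  -- an integer with non-real image
  obtain ⟨ω, hω⟩ : ∃ ω : 𝓞 K, (σK (ω : K)).im ≠ 0 := by
    by_cases hex : ∃ ω : 𝓞 K, (σK (ω : K)).im ≠ 0
    · exact hex
    exfalso
    have hall : ∀ ω : 𝓞 K, (σK (ω : K)).im = 0 := fun ω ↦ Classical.byContradiction fun h ↦ hex ⟨ω, h⟩
    have hreal : ComplexEmbedding.IsReal σK := by
      rw [ComplexEmbedding.isReal_iff]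
      ext x
      obtain ⟨y, z, hz, rfl⟩ := IsFractionRing.div_surjective (A := 𝓞 K) x
      rw [ComplexEmbedding.conjugate_coe_eq, map_div₀, map_div₀]
      have hy : conj (σK (y : K)) = σK (y : K) := Complex.conj_eq_iff_im.mpr (hall y)
      have hz' : conj (σK (z : K)) = σK (z : K) := Complex.conj_eq_iff_im.mpr (hall z)
      rw [hy, hz']
    exact InfinitePlace.not_isReal_of_mk_isComplex (IsTotallyComplex.isComplex _) hreal
  set N : ℕ := Ideal.absNorm I with hN
  have hN0 : N ≠ 0 := by rw [hN, Ne, Ideal.absNorm_eq_zero_iff]; exact hI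
  have hNmem : ((N : ℕ) : 𝓞 K) ∈ I := Ideal.absNorm_mem I
  have him : (σK ((1 + (N : 𝓞 K) * ω : 𝓞 K) : K)).im ≠ 0 := by
    have h1 : σK ((1 + (N : 𝓞 K) * ω : 𝓞 K) : K) = 1 + (N : ℂ) * σK (ω : K) := by
      push_cast
      rw [map_add, map_one, map_mul, map_natCast]
    rw [h1, Complex.add_im, Complex.one_im, zero_add, Complex.mul_im, Complex.natCast_re, Complex.natCast_im, zero_mul, add_zero]
    exact mul_ne_zero (Nat.cast_ne_zero.mpr hN0) hω
  refine ⟨1 + (N : 𝓞 K) * ω, fun h0 ↦ ?_, ?_, him⟩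
  · rw [h0] at him
    simp at him
  · rw [add_sub_cancel_left]; exact I.mul_mem_right _ hNmem

/-- ★ **A Grössencharakter of type `(1,0)` is not real-valued off its modulus**: if `\overline{ψ(w)} = ψ(w)` for all `w ∤ 𝔪`, then for
`α ≡ 1 (𝔪)` with `σK(α) ∉ ℝ` the value `ψ((α)) = σK(α)` (the infinity type) would be real. [cite: NeukirchANT1999, Ch. VII §6 Def. (6.1)] -/
theorem not_forall_conj_eq_self {𝔪 : Ideal (𝓞 K)} (h𝔪 : 𝔪 ≠ ⊥) {ψ : HeightOneSpectrum (𝓞 K) → ℂ}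
    (hψ : IsGrossencharakter 𝔪 (embType σK) (embTypeConj σK) ψ)
    (hreal : ∀ w : HeightOneSpectrum (𝓞 K), ¬ 𝔪 ≤ w.asIdeal → conj (ψ w) = ψ w) : False := by
  obtain ⟨α, hα0, hα1, hαim⟩ := exists_sub_one_mem_im_ne_zero σK h𝔪
  -- `ψ((α)) = σK(α)`
  have hval : idealPow K ψ (Ideal.span {α}) = σK (α : K) := idealPow_span_singleton_eq_of_sub_one_mem σK hψ hα0 hα1
  -- `ψ((α))` is real: every prime factor of `(α)` is prime to `𝔪`
  have hreal' : conj (idealPow K ψ (Ideal.span {α})) = idealPow K ψ (Ideal.span {α}) := by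
    have hα0' : (Ideal.span {α} : Ideal (𝓞 K)) ≠ ⊥ := by rwa [Ne, Ideal.span_singleton_eq_bot]
    unfold idealPow
    rw [map_finprod _ (mulSupport_idealPow_finite ψ hα0')]
    refine finprod_congr fun v ↦ ?_
    rw [map_pow]
    by_cases hc : (Associates.mk v.asIdeal).count (Associates.mk (Ideal.span {α})).factors = 0
    · rw [hc, pow_zero, pow_zero]
    · have hdvd : v.asIdeal ∣ Ideal.span {α} := (Associates.count_ne_zero_iff_dvd hα0' v.irreducible).mp hc
      have hv : ¬ 𝔪 ≤ v.asIdeal := fun hle ↦ by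
        have h1 : α ∈ v.asIdeal := Ideal.le_of_dvd hdvd (Ideal.mem_span_singleton_self α)
        have h2 : α - 1 ∈ v.asIdeal := hle hα1
        have h3 : (1 : 𝓞 K) ∈ v.asIdeal := by simpa using v.asIdeal.sub_mem h1 h2
        exact v.isPrime.ne_top ((Ideal.eq_top_iff_one _).mpr h3)
      rw [hreal v hv]
  rw [hval] at hreal'
  exact hαim (Complex.conj_eq_iff_im.mp hreal')

end NotReal

/-! ## §5. CM-reality from uniqueness up to conjugation -/

section Glue

variable [IsTotallyComplex K] (σK : K →+* ℂ) (c : K ≃ₐ[ℚ] K)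

set_option maxHeartbeats 800000 in
/-- ★★ **CM-REALITY OF THE CRUX's GRÖSSENCHARAKTER from UNIQUENESS UP TO CONJUGATION.** Data: the crux prefix's `σK`, `𝔪 ≠ 0`, `ψ` with
`hψ : IsGrossencharakter 𝔪 (embType σK) (embTypeConj σK) ψ`, the CM newform `g` (`IsNewform0 g`) with `p`-adic embedding `ι` and `e : ℚ̄_p ≃ ℂ`, the
prime-trace pin `hcoeffψ` off the finitely many `ℓ ∣ D`; an involution `c` of `K` with `σK ∘ c = \overline{σK}` (complex conjugation). Hypothesis `hU`
(UNIQUENESS UP TO CONJUGATION, Ribet 1977 §3–§4 / strong multiplicity one for Grössencharaktere): any Grössencharakter `ψ′` (mod `𝔪′`, same type) with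
the same prime-trace sums off `D` agrees with `ψ` off `𝔪𝔪′`, or with `ψ ∘ c`. Conclusion: `ψ(c • w) = \overline{ψ(w)}` for every `w ∤ 𝔪` with `c • w ∤ 𝔪`
(the two-sided premise `hψc` of `prop159_values_inert_hV_frame_of_isGrossencharakter₂`). Proof: `ψ′ := \overline{ψ ∘ c}` is a Grössencharakter mod `c • 𝔪`
with the same traces (`a_ℓ(g′) ∈ ℝ` for the conjugate newform `g′ = g^{e∘ι}`: tree `GaloisConjugate.exists_isNewform0_conj`, `IsNewform0.conj_cuspCoeff`);
the alternative `ψ′ = ψ ∘ c` makes `ψ` real-valued off `𝔪`, excluded by `not_forall_conj_eq_self`.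
[cite: Ribet1977Nebentypus, §3 (forms with complex multiplication)] [cite: Shimura1971, Thm. 3.48] [cite: SilvermanATAEC1994, Ch. II Ex. 2.30] -/
theorem hψc_of_uniq (hc2 : c * c = 1) (hσc : ∀ x : K, σK (c x) = conj (σK x))
    {𝔪 : Ideal (𝓞 K)} (h𝔪 : 𝔪 ≠ ⊥) {ψ : HeightOneSpectrum (𝓞 K) → ℂ} (hψ : IsGrossencharakter 𝔪 (embType σK) (embTypeConj σK) ψ)
    {p : ℕ} [Fact p.Prime] (e : PadicAlgCl p ≃+* ℂ) {M : ℕ} [NeZero M] (g : CuspForm (Gamma0 M) 2) (ι : coeffField g →+* PadicAlgCl p)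
    (hng : IsNewform0 g) {D : ℕ}
    (hcoeffψ : ∀ ℓ : ℕ, ℓ.Prime → ¬ ℓ ∣ D →
      embCoeff g ι ℓ = e.symm (∑ᶠ (w : HeightOneSpectrum (𝓞 K)) (_ : Ideal.absNorm w.asIdeal = ℓ), ψ w))
    (hU : ∀ (𝔪' : Ideal (𝓞 K)) (ψ' : HeightOneSpectrum (𝓞 K) → ℂ), 𝔪' ≠ ⊥ → IsGrossencharakter 𝔪' (embType σK) (embTypeConj σK) ψ' →
      (∀ ℓ : ℕ, ℓ.Prime → ¬ ℓ ∣ D →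
        ∑ᶠ (w : HeightOneSpectrum (𝓞 K)) (_ : Ideal.absNorm w.asIdeal = ℓ), ψ' w =
          ∑ᶠ (w : HeightOneSpectrum (𝓞 K)) (_ : Ideal.absNorm w.asIdeal = ℓ), ψ w) →
      (∀ w : HeightOneSpectrum (𝓞 K), ¬ 𝔪 ≤ w.asIdeal → ¬ 𝔪' ≤ w.asIdeal → ψ' w = ψ w) ∨
        (∀ w : HeightOneSpectrum (𝓞 K), ¬ 𝔪 ≤ (c • w).asIdeal → ¬ 𝔪' ≤ w.asIdeal → ψ' w = ψ (c • w))) :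
    ∀ w : HeightOneSpectrum (𝓞 K), ¬ 𝔪 ≤ w.asIdeal → ¬ 𝔪 ≤ (c • w).asIdeal → ψ (c • w) = conj (ψ w) := by
  intro w hw hcw
  have hψ' := isGrossencharakter_conj_smul σK c hc2 hσc hψ
  have h𝔪' : c • 𝔪 ≠ ⊥ := fun h ↦ h𝔪 ((Ideal.smul_eq_bot_iff c 𝔪).mp h)
  -- the conjugate newform `g′ = g^{e∘ι}` and the reality of its coefficients give the trace identities
  obtain ⟨g', hg', hcoeff'⟩ := GaloisConjugate.exists_isNewform0_conj le_rfl g hng ((e : PadicAlgCl p →+* ℂ).comp ι)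
  have htr : ∀ ℓ : ℕ, ℓ.Prime → ¬ ℓ ∣ D →
      ∑ᶠ (w : HeightOneSpectrum (𝓞 K)) (_ : Ideal.absNorm w.asIdeal = ℓ), conj (ψ (c • w)) =
        ∑ᶠ (w : HeightOneSpectrum (𝓞 K)) (_ : Ideal.absNorm w.asIdeal = ℓ), ψ w := by
    intro ℓ hℓ hℓD
    have hS : ∑ᶠ (w : HeightOneSpectrum (𝓞 K)) (_ : Ideal.absNorm w.asIdeal = ℓ), ψ w = cuspCoeff g' ℓ := by
      rw [hcoeff' ℓ]
      show _ = e (embCoeff g ι ℓ)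
      rw [hcoeffψ ℓ hℓ hℓD, RingEquiv.apply_symm_apply]
    rw [finsum_conj_smul_eq, hS]
    exact hg'.conj_cuspCoeff ℓ
  rcases hU (c • 𝔪) (fun w ↦ conj (ψ (c • w))) h𝔪' hψ' htr with h | h
  · -- `ψ′ = ψ` at `w`: CM-reality
    have hcw' : ¬ c • 𝔪 ≤ w.asIdeal := by
      rwa [HeightOneSpectrum.smul_asIdeal, le_smul_iff_smul_le hc2] at hcw
    rw [← h w hw hcw', Complex.conj_conj]
  · -- `ψ′ = ψ ∘ c`: `ψ` would be real-valued off `𝔪`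
    exfalso
    refine not_forall_conj_eq_self σK h𝔪 hψ fun u hu ↦ ?_
    have hcu : c • (c • u) = u := by rw [smul_smul, hc2, one_smul]
    have h1 := h (c • u) (by rw [hcu]; exact hu)
      (by rw [HeightOneSpectrum.smul_asIdeal, Ideal.pointwise_smul_le_pointwise_smul_iff]; exact hu)
    rwa [hcu] at h1

end Glue

end Summit.BirchSwinnertonDyer.BirchSwinnertonDyer.Theorems.SmallImageRttF1Bridge

end
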